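import Literature.AlgebraicGeometry.HodgeTheory.HodgeModelTopFormOfClass
import Literature.AlgebraicGeometry.HodgeTheory.IsoTransport
import Literature.AlgebraicGeometry.HodgeTheory.FermatHypersurfaceReduction
import Literature.AlgebraicGeometry.HodgeTheory.JacobianHodgeGenus
import Literature.AlgebraicGeometry.Motives.GeometricVHSPolarizedTransport
import HarnessLib

/-!
# Hodge frames of the top filtration step transport along isomorphisms of smooth projective varieties

Topic `AlgebraicGeometry/HodgeTheory`; namespace `Literature.AlgebraicGeometry.HodgeTheory`.  KERNEL ONLY:
theorems; no definition, no named fact, no instance, no `sorry`.  Cell `hodgecm-mathlib` (D-0151), rung-0 (U)-road,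
node U-e P4, PLAN v0.6 (B-p03 (g13)) seam **(S-3) «Hodge-type transfer»** for the (B1b) step «Siegel-normalised
Hodge-frame markings»: Griffiths' theorem (★ `UnivFamilyHodgeFrames.exists_hodgeFrames_familyPullback_univFamilyℂ`)
delivers, on a chart-small `W`, frames `w₁(x), …, w_r(x)` of the Hodge filtration step `FᵏHᵏ(X_x)` of the FIBRE `X_x`
of the universal family, written on `ℂ ⊗_ℚ Hᵏ(X_{x₀}(ℂ); ℚ)` through the flat transport
`T_x : Hᵏ(X_{x₀}; ℚ) ≃ Hᵏ(X_x; ℚ)` as the equation `((B_x.hodgeStructure …).comapEquiv T_x).F k = span {wᵢ(x)}`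
for a Hodge-symmetric Hodge model `B_x` of `X_x`; the per-fibre Siegel-point engine (★
`exists_siegelAdelicMarking_of_hodgeFrame`) wants instead, on the MARKED abelian variety `A_x` identified with the
fibre by the pinned isomorphism `ε_x : A_x.X ≅ X_x` (on complex points: ★ `AlgPoints.homeomorphOfIso ε_x`), a
`ℂ`-linearly independent family of classes of `ℂ ⊗_ℚ H¹(A_x(ℂ); ℚ)` each OF HODGE TYPE `(1, 0)` in the tree's sense
(★ `IsOfHodgeType A_x.dim A_x.X 1 1 0`), and `r = A_x.dim` of them.  This file is that bookkeeping, generic in the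
degree `k` (the top step `FᵏHᵏ = H^{k,0}`) and in the smooth projective `X`:

* §1 `HodgeModel.hodgeStructure_F_top` — `FᵏHᵏ = H^{k,0}` for the Hodge structure of a Hodge-symmetric model
  (★ `HodgeModel.hodgeStructure`, ★ `HodgeModel.ratF_self_eq_ratPiece` of `HodgeModelTopFormOfClass`: only `(k, 0)`
  has `p ≥ k` on the antidiagonal); `HodgeModel.isOfHodgeType_of_mem_ratPiece` / `…_of_mem_hodgeStructure_F_top` (the model itself is
  the witness) and, by independence of the model (★ `hodgePQ_independent_of_hodgeModel_holds`),
  `HodgeModel.mem_ratPiece_iff_isOfHodgeType`;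
* §2 `HodgeModel.isOfHodgeType_of_mem_comapEquiv_F_top` — the same read through ★ `HodgeStructure.comapEquiv T`
  (`F p = T_ℂ⁻¹(F p)`, ★ `comapEquiv_F`);
* §3 (private `rfl` plumbing: the pinned homeomorphism IS `ε(ℂ)` as a continuous map),
  `isOfHodgeType_baseChange_map_homeomorphOfIso_iff` — Hodge types are invariant under `ε^*` for an isomorphism
  `ε : X' ≅ X` (★ `isOfHodgeType_map_iff_of_iso` + naturality ★ `ofRatClassBaseChange_baseChange_map`), with the
  dimension index rewritten along `m = n` (the consumer has `A_x.dim = g` from ★ `AbelianSchemeOver.dim_fibre_of_isOfRelDim`);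
  `linearIndependent_baseChange_map_homeomorph` (pull-back along a homeomorphism is an isomorphism on `Hᵏ(–; ℚ)`,
  ★ `singularCohomology.mapIso`, so its complexification preserves linear independence);
* §4 HEAD `hodgeFrame_transport_of_iso` — from `F k = span {wᵢ}` (p712353's clause verbatim), `LinearIndependent ℂ w`,
  `ε : X' ≅ X` and `m = n`: the transported frame `wᵢ' := (ε(ℂ)^* ⊗ ℂ)(T_ℂ wᵢ)` is linearly independent and every
  `wᵢ' ⊗ 1` is of Hodge type `(k, 0)` on `X'` in dimension `m`;
* §5 `finrank_hodgeStructure_F_one_eq_finrank_hodgeOneZero`, `card_hodgeFrame_eq_dim_of_iso` — for `k = 1` the frame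
  has `r = A'.dim` members when `X' = A'.X` is a complex abelian variety (★ `AbelianVariety.finrank_hodgeOneZero_eq_dim`:
  `h^{1,0}(A) = dim A`).

PRINT. [VoisinHodgeI2002] §7.1.1 (Hodge filtration `FᵖV_ℂ = ⊕_{r ≥ p} V^{r,k-r}`, so `Fᵏ Hᵏ = H^{k,0}`), §7.3.2 («`φ^*` is a
morphism of Hodge structures» — for an isomorphism, an isomorphism of Hodge structures), §10.2.1 Thm. 10.3 (holomorphic
frames of `Fᵖ`); [Lange2023AbelianVarietiesComplex] §1.1.5 Thm. 1.1.21 (b) (`H^{1,0}(X) = Hom_ℂ(V, ℂ)`, of dimension `g`);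
[MumfordAV1970] §1 (4) (`h^{1,0} = g`).  HC_CM is proved only modulo the 7 printed citations until rung 0 closes; nothing
here changes that count (books 0).

## References
* [VoisinHodgeI2002] C. Voisin, *Hodge Theory and Complex Algebraic Geometry I* (2002), §7.1.1 Def. 7.4, §7.3.2, §10.2.1 Thm. 10.3.
* [Lange2023AbelianVarietiesComplex] H. Lange, *Abelian Varieties over the Complex Numbers* (2023), §1.1.5 Thm. 1.1.21 (b) (p. 15).
* [MumfordAV1970] D. Mumford, *Abelian Varieties* (1970), §1 (4).
* [SerreGAGA1956] J.-P. Serre, *Géométrie algébrique et géométrie analytique* (1956), §2.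
-/

set_option autoImplicit false

noncomputable section

open scoped TensorProduct
open CategoryTheory
open Literature.AlgebraicTopology.SingularHomology
open Literature.AlgebraicGeometry.Motives (ofRatClassBaseChange ComplexPoints IsSmoothProjective AbelianVariety AlgPoints)

universe u

namespace Literature.AlgebraicGeometry.HodgeTheory

/-! ### §1 The top filtration step `FᵏHᵏ = H^{k,0}` of the Hodge structure of a model -/

namespace HodgeModel

variable {n : ℕ} {X : Motives.SchemeOver ℂ} (A : HodgeModel n X) (hX : IsSmoothProjective n X)

/-- **`Fᵏ Hᵏ(X(ℂ); ℚ)_ℂ = Θ_A⁻¹(H^{k,0})`** for the Hodge structure of a Hodge-symmetric model (★ `hodgeStructure_F`).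
[cite: VoisinHodgeI2002, §7.1.1 Def. 7.4] -/
theorem hodgeStructure_F_top (hA : A.IsHodgeSymmetric) (k : ℕ) :
    (A.hodgeStructure hX hA k).F k = A.ratPiece hX k k 0 := by
  rw [hodgeStructure_F, ratF_self_eq_ratPiece]

/-- A class of `Θ_A⁻¹(H^{p,q})` is of Hodge type `(p, q)` in the tree's sense — the model `A` is the witness.
[cite: VoisinHodgeI2002, §7.1.1] -/
theorem isOfHodgeType_of_mem_ratPiece {k p q : ℕ}
    {x : ℂ ⊗[ℚ] singularCohomology ℚ ℚ (ComplexPoints X) k} (hx : x ∈ A.ratPiece hX k p q) :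
    IsOfHodgeType n X k p q (ofRatClassBaseChange (ComplexPoints X) k x) :=
  ⟨A, hx⟩

/-- Conversely a class of Hodge type `(p, q)` (for SOME model) lies in `Θ_A⁻¹(H^{p,q})` — all Hodge models cut out the
same `H^{p,q}` (★ `hodgePQ_independent_of_hodgeModel_holds`). [cite: VoisinHodgeI2002, §7.1.1] -/
theorem mem_ratPiece_of_isOfHodgeType {k p q : ℕ}
    {x : ℂ ⊗[ℚ] singularCohomology ℚ ℚ (ComplexPoints X) k}
    (h : IsOfHodgeType n X k p q (ofRatClassBaseChange (ComplexPoints X) k x)) :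
    x ∈ A.ratPiece hX k p q := by
  obtain ⟨A', hA'⟩ := h
  exact hodgePQ_independent_of_hodgeModel_holds n X hX A' A k p q _ hA'

/-- `x ∈ Θ_A⁻¹(H^{p,q}) ↔ x ⊗ 1` is of Hodge type `(p, q)`. [cite: VoisinHodgeI2002, §7.1.1] -/
theorem mem_ratPiece_iff_isOfHodgeType {k p q : ℕ}
    (x : ℂ ⊗[ℚ] singularCohomology ℚ ℚ (ComplexPoints X) k) :
    x ∈ A.ratPiece hX k p q ↔ IsOfHodgeType n X k p q (ofRatClassBaseChange (ComplexPoints X) k x) :=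
  ⟨A.isOfHodgeType_of_mem_ratPiece hX, A.mem_ratPiece_of_isOfHodgeType hX⟩

/-- **A class of the top step `Fᵏ` of the Hodge structure of a model is of Hodge type `(k, 0)`** (`k = 1`: the
classes of `F¹H¹` are the `(1, 0)`-classes). [cite: VoisinHodgeI2002, §7.1.1 Def. 7.4] -/
theorem isOfHodgeType_of_mem_hodgeStructure_F_top (hA : A.IsHodgeSymmetric) {k : ℕ}
    {x : ℂ ⊗[ℚ] singularCohomology ℚ ℚ (ComplexPoints X) k} (hx : x ∈ (A.hodgeStructure hX hA k).F k) :
    IsOfHodgeType n X k k 0 (ofRatClassBaseChange (ComplexPoints X) k x) := by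
  rw [hodgeStructure_F_top] at hx
  exact A.isOfHodgeType_of_mem_ratPiece hX hx

/-- Conversely a `(k, 0)`-class lies in `Fᵏ`. [cite: VoisinHodgeI2002, §7.1.1 Def. 7.4] -/
theorem mem_hodgeStructure_F_top_of_isOfHodgeType (hA : A.IsHodgeSymmetric) {k : ℕ}
    {x : ℂ ⊗[ℚ] singularCohomology ℚ ℚ (ComplexPoints X) k}
    (h : IsOfHodgeType n X k k 0 (ofRatClassBaseChange (ComplexPoints X) k x)) :
    x ∈ (A.hodgeStructure hX hA k).F k := by
  rw [hodgeStructure_F_top]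
  exact A.mem_ratPiece_of_isOfHodgeType hX h

/-! ### §2 … read through the transport `comapEquiv T` -/

/-- **Through a transported Hodge structure**: if `w ∈ Fᵏ` of `(A.hodgeStructure …).comapEquiv T` for a `ℚ`-linear
`T : V ≃ Hᵏ(X(ℂ); ℚ)` (★ `comapEquiv_F`: `Fᵖ = T_ℂ⁻¹(Fᵖ)`), then `T_ℂ w ⊗ 1` is of Hodge type `(k, 0)` — the shape in which
Griffiths' frames are delivered (flat transport `T` from a reference fibre). [cite: VoisinHodgeI2002, §7.1.1 and §10.2.1 Thm. 10.3] -/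
theorem isOfHodgeType_of_mem_comapEquiv_F_top (hA : A.IsHodgeSymmetric) {k : ℕ} {V : Type u} [AddCommGroup V]
    [Module ℚ V] (T : V ≃ₗ[ℚ] singularCohomology ℚ ℚ (ComplexPoints X) k) {w : ℂ ⊗[ℚ] V}
    (hw : w ∈ ((A.hodgeStructure hX hA k).comapEquiv T).F k) :
    IsOfHodgeType n X k k 0 (ofRatClassBaseChange (ComplexPoints X) k (T.toLinearMap.baseChange ℂ w)) :=
  A.isOfHodgeType_of_mem_hodgeStructure_F_top hX hA
    (by rwa [Motives.HodgeStructure.comapEquiv_F] at hw)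

end HodgeModel

/-! ### §3 Transport along an isomorphism `ε : X' ≅ X`, in the `homeomorphOfIso` spelling -/

section Iso

variable {n m : ℕ} {X X' : Motives.SchemeOver ℂ}

/-- The pinned homeomorphism of complex points of an isomorphism `ε`, as a continuous map, IS `ε(ℂ)`
(★ `AlgPoints.coe_homeomorphOfIso`; `rfl` — consumers restate it inline). [folklore] -/
private theorem AlgPoints.coe_homeomorphOfIso_eq_mapContinuous (ε : X' ≅ X) :
    ((Motives.AlgPoints.homeomorphOfIso (L := ℂ) ε : ComplexPoints X' ≃ₜ ComplexPoints X) :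
        C(ComplexPoints X', ComplexPoints X)) =
      Motives.AlgPoints.mapContinuous (L := ℂ) ε.hom :=
  rfl

/-- **Hodge types are invariant under isomorphisms**, `homeomorphOfIso` spelling with a dimension rewrite: for
`ε : X' ≅ X`, `m = n` and `x ∈ ℂ ⊗_ℚ Hᵏ(X(ℂ); ℚ)`, the class `(ε(ℂ)^* ⊗ ℂ) x ⊗ 1` on `X'` is of type `(p, q)` in dimension
`m` iff `x ⊗ 1` is on `X` in dimension `n` (★ `isOfHodgeType_map_iff_of_iso`, naturality ★
`ofRatClassBaseChange_baseChange_map`). [cite: VoisinHodgeI2002, §7.3.2] [cite: SerreGAGA1956, §2] -/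
theorem isOfHodgeType_baseChange_map_homeomorphOfIso_iff (ε : X' ≅ X) (hm : m = n) {k p q : ℕ}
    (x : ℂ ⊗[ℚ] singularCohomology ℚ ℚ (ComplexPoints X) k) :
    IsOfHodgeType m X' k p q (ofRatClassBaseChange (ComplexPoints X') k
      ((singularCohomology.map ℚ ℚ
          ((Motives.AlgPoints.homeomorphOfIso (L := ℂ) ε : ComplexPoints X' ≃ₜ ComplexPoints X) :
            C(ComplexPoints X', ComplexPoints X)) k).hom.baseChange ℂ x)) ↔
      IsOfHodgeType n X k p q (ofRatClassBaseChange (ComplexPoints X) k x) := by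
  subst hm
  rw [AlgPoints.coe_homeomorphOfIso_eq_mapContinuous, HodgeModel.ofRatClassBaseChange_baseChange_map]
  exact isOfHodgeType_map_iff_of_iso ε

/-- **Pull-back along a homeomorphism preserves linear independence of complexified rational classes**: `e^*` is an
isomorphism on `Hᵏ(–; ℚ)` (★ `singularCohomology.mapIso`), so `e^* ⊗ ℂ` is injective. [cite: HatcherAT2002, §3.1] -/
theorem linearIndependent_baseChange_map_homeomorph {Y Y' : Type u} [TopologicalSpace Y] [TopologicalSpace Y']
    (e : Y' ≃ₜ Y) (k : ℕ) {ι : Type*} {w : ι → ℂ ⊗[ℚ] singularCohomology ℚ ℚ Y k}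
    (hli : LinearIndependent ℂ w) :
    LinearIndependent ℂ fun i ↦
      (singularCohomology.map ℚ ℚ (e : C(Y', Y)) k).hom.baseChange ℂ (w i) := by
  -- `e^*` on `Hᵏ(–; ℚ)` is the linear equivalence underlying `mapIso e`; its base change is a linear equivalence
  set E : singularCohomology ℚ ℚ Y k ≃ₗ[ℚ] singularCohomology ℚ ℚ Y' k :=
    (singularCohomology.mapIso (R := ℚ) (M := ℚ) e k).toLinearEquiv with hE
  have hEq : (singularCohomology.map ℚ ℚ (e : C(Y', Y)) k).hom.baseChange ℂ = (E.baseChange ℚ ℂ _ _).toLinearMap := by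
    rfl
  rw [hEq]
  exact hli.map' _ (E.baseChange ℚ ℂ _ _).ker

end Iso

/-! ### §4 HEAD: a Hodge frame of `FᵏHᵏ(X)` transported to `X' ≅ X` is a frame of `(k,0)`-classes -/

/-- **(S-3) HODGE-FRAME TRANSPORT ALONG AN ISOMORPHISM.**  Let `X` be smooth projective of dimension `n` with a
Hodge-symmetric Hodge model `A`, `T : V ≃ Hᵏ(X(ℂ); ℚ)` a `ℚ`-linear identification (flat transport from a reference
fibre), and `w : Fin r → ℂ ⊗_ℚ V` a linearly independent family SPANNING `Fᵏ` of `(A.hodgeStructure …).comapEquiv T`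
(Griffiths' frame clause, ★ p712353, verbatim).  Then for every isomorphism `ε : X' ≅ X` and `m = n`, the transported
family `wᵢ' := (ε(ℂ)^* ⊗ ℂ)(T_ℂ wᵢ) ∈ ℂ ⊗_ℚ Hᵏ(X'(ℂ); ℚ)` — pull-back along the pinned ★ `AlgPoints.homeomorphOfIso ε` — is
`ℂ`-linearly independent and every `wᵢ' ⊗ 1` is of Hodge type `(k, 0)` on `X'` in dimension `m` (the hypotheses `hli`,
`hw` of ★ `exists_siegelAdelicMarking_of_hodgeFrame` for `k = 1`).
[cite: VoisinHodgeI2002, §7.1.1 Def. 7.4, §7.3.2 and §10.2.1 Thm. 10.3] -/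
theorem hodgeFrame_transport_of_iso {n m : ℕ} {X X' : Motives.SchemeOver ℂ} (hX : IsSmoothProjective n X)
    (A : HodgeModel n X) (hA : A.IsHodgeSymmetric) {k : ℕ} {V : Type u} [AddCommGroup V] [Module ℚ V]
    (T : V ≃ₗ[ℚ] singularCohomology ℚ ℚ (ComplexPoints X) k) {r : ℕ} {w : Fin r → ℂ ⊗[ℚ] V}
    (hF : ((A.hodgeStructure hX hA k).comapEquiv T).F k = Submodule.span ℂ (Set.range w))
    (hli : LinearIndependent ℂ w) (ε : X' ≅ X) (hm : m = n) :
    LinearIndependent ℂ (fun i ↦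
        (singularCohomology.map ℚ ℚ
            ((Motives.AlgPoints.homeomorphOfIso (L := ℂ) ε : ComplexPoints X' ≃ₜ ComplexPoints X) :
              C(ComplexPoints X', ComplexPoints X)) k).hom.baseChange ℂ (T.toLinearMap.baseChange ℂ (w i))) ∧
      ∀ i, IsOfHodgeType m X' k k 0 (ofRatClassBaseChange (ComplexPoints X') k
        ((singularCohomology.map ℚ ℚ
            ((Motives.AlgPoints.homeomorphOfIso (L := ℂ) ε : ComplexPoints X' ≃ₜ ComplexPoints X) :
              C(ComplexPoints X', ComplexPoints X)) k).hom.baseChange ℂ (T.toLinearMap.baseChange ℂ (w i)))) := by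
  refine ⟨?_, fun i ↦ ?_⟩
  · refine linearIndependent_baseChange_map_homeomorph _ k ?_
    exact hli.map' _ (LinearMap.ker_eq_bot.2 (Motives.HodgeStructure.baseChange_injective_of_equiv T))
  · rw [isOfHodgeType_baseChange_map_homeomorphOfIso_iff ε hm]
    refine A.isOfHodgeType_of_mem_comapEquiv_F_top hX hA T ?_
    rw [hF]
    exact Submodule.subset_span ⟨i, rfl⟩

/-! ### §5 Rank: for `k = 1` the frame has `dim` members on an abelian variety -/

section Rank

variable {n : ℕ} {X : Motives.SchemeOver ℂ}

/-- **`dim_ℂ F¹H¹ = dim_ℂ H^{1,0}(X)`**: the top step of the Hodge structure of a model, a subspace of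
`ℂ ⊗_ℚ H¹(X(ℂ); ℚ)`, is carried by the complexification `ℂ ⊗_ℚ H¹(X(ℂ); ℚ) ≅ H¹(X(ℂ); ℂ)` (★ `ofRatClassBaseChange`,
bijective for smooth projective `X`) onto the tree's `hodgeOneZero` (§1). [cite: VoisinHodgeI2002, §7.1.1] -/
theorem finrank_hodgeStructure_F_one_eq_finrank_hodgeOneZero (A : HodgeModel n X) (hX : IsSmoothProjective n X)
    (hA : A.IsHodgeSymmetric) :
    Module.finrank ℂ ((A.hodgeStructure hX hA 1).F 1) = Module.finrank ℂ (hodgeOneZero hX) := by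
  -- the complexification as a linear equivalence
  set Θ : (ℂ ⊗[ℚ] singularCohomology ℚ ℚ (ComplexPoints X) 1) ≃ₗ[ℂ] complexBetti X 1 :=
    LinearEquiv.ofBijective (ofRatClassBaseChange (ComplexPoints X) 1)
      ⟨ofRatClassBaseChange_injective _ 1, ofRatClassBaseChange_surjective hX 1⟩ with hΘ
  have hmap : Submodule.map (Θ : _ →ₗ[ℂ] _) ((A.hodgeStructure hX hA 1).F 1) = hodgeOneZero hX := by
    ext c
    constructor
    · rintro ⟨x, hx, rfl⟩
      exact (mem_hodgeOneZero hX).2 (A.isOfHodgeType_of_mem_hodgeStructure_F_top hX hA hx)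
    · intro hc
      obtain ⟨x, rfl⟩ := ofRatClassBaseChange_surjective hX 1 c
      exact ⟨x, A.mem_hodgeStructure_F_top_of_isOfHodgeType hX hA ((mem_hodgeOneZero hX).1 hc), rfl⟩
  rw [← hmap]
  exact (LinearEquiv.finrank_map_eq Θ _).symm

/-- **A HODGE FRAME OF `F¹H¹` HAS `dim` MEMBERS on a complex abelian variety** (`h^{1,0}(A') = dim A'`, ★
`AbelianVariety.finrank_hodgeOneZero_eq_dim`, transported along `ε : A'.X ≅ X`): with the data of
`hodgeFrame_transport_of_iso` at `k = 1` and `X' = A'.X`, `r = A'.dim`. [cite: MumfordAV1970, §1 (4)]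
[cite: Lange2023AbelianVarietiesComplex, §1.1.5 Thm. 1.1.21 (b) (p. 15)] -/
theorem card_hodgeFrame_eq_dim_of_iso {m : ℕ} (A' : AbelianVariety ℂ) (hA' : IsSmoothProjective m A'.X)
    (hX : IsSmoothProjective n X) (A : HodgeModel n X) (hA : A.IsHodgeSymmetric) {V : Type u} [AddCommGroup V]
    [Module ℚ V] (T : V ≃ₗ[ℚ] singularCohomology ℚ ℚ (ComplexPoints X) 1) {r : ℕ} {w : Fin r → ℂ ⊗[ℚ] V}
    (hF : ((A.hodgeStructure hX hA 1).comapEquiv T).F 1 = Submodule.span ℂ (Set.range w))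
    (hli : LinearIndependent ℂ w) (ε : A'.X ≅ X) (hm : m = n) : r = A'.dim := by
  subst hm
  -- `r = dim F¹ (on V) = dim F¹ (on H¹(X)) = dim H^{1,0}(X) = dim H^{1,0}(A') = dim A'`
  have h1 : Module.finrank ℂ (((A.hodgeStructure hX hA 1).comapEquiv T).F 1) = r := by
    rw [hF, finrank_span_eq_card hli, Fintype.card_fin]
  have h2 : Module.finrank ℂ (((A.hodgeStructure hX hA 1).comapEquiv T).F 1) =
      Module.finrank ℂ ((A.hodgeStructure hX hA 1).F 1) := by
    rw [Motives.HodgeStructure.comapEquiv_F]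
    exact LinearEquiv.finrank_eq (LinearEquiv.ofSubmodule' (T.baseChange ℚ ℂ V _) ((A.hodgeStructure hX hA 1).F 1))
  -- `H^{1,0}(A') ≅ H^{1,0}(X)` along `ε(ℂ)^*`
  have h3 : Module.finrank ℂ (hodgeOneZero hA') = Module.finrank ℂ (hodgeOneZero hX) := by
    set E : complexBetti X 1 ≃ₗ[ℂ] complexBetti A'.X 1 :=
      LinearEquiv.ofBijective (complexBetti.map ε.hom 1).hom (complexBetti.bijective_map_of_iso ε 1) with hE
    have hmap : Submodule.map (E : _ →ₗ[ℂ] _) (hodgeOneZero hX) = hodgeOneZero hA' := by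
      ext c
      constructor
      · rintro ⟨x, hx, rfl⟩
        exact (mem_hodgeOneZero hA').2 ((isOfHodgeType_map_iff_of_iso ε).2 ((mem_hodgeOneZero hX).1 hx))
      · intro hc
        obtain ⟨x, rfl⟩ := (complexBetti.bijective_map_of_iso ε 1).2 c
        exact ⟨x, (mem_hodgeOneZero hX).2 ((isOfHodgeType_map_iff_of_iso ε).1 ((mem_hodgeOneZero hA').1 hc)), rfl⟩
    rw [← hmap]
    exact LinearEquiv.finrank_map_eq E _
  rw [← AbelianVariety.finrank_hodgeOneZero_eq_dim A' hA', h3,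
    ← finrank_hodgeStructure_F_one_eq_finrank_hodgeOneZero A hX hA, ← h2, h1]

end Rank

end Literature.AlgebraicGeometry.HodgeTheory

end
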